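import Summits.AnomalousDissipation.AnomalousDissipation.Theses.ImpulseGrid
import Summits.AnomalousDissipation.AnomalousDissipation.Theorems.MarginalStabilityChainChainRealisationStubLoudOfContrast
import Literature.Analysis.FluidPDE.TorusClassicalLerayHopfProofs
import Literature.Analysis.FluidPDE.LongTimeAverageSubadditive
import Literature.Analysis.FluidPDE.LongTimeAverageNonneg
import Literature.Analysis.FunctionSpaces.TorusClassicalNSGluing
import Literature.Analysis.FunctionSpaces.TorusFourierCalculus

/-!
# Stub `stub_classicalWitnessReduction` of the line `Sketch`
# (crux `ImpulseGrid.BoundedEnergyNoLeakGrid`, stmt-AnomalousDissipation-14350)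

Sorry-free discharge of the registered stub `stub_classicalWitnessReduction` of the lead's skeleton
(`Cruxes/BoundedEnergyNoLeakGrid`, line `Sketch`): the **bookkeeping reduction** showing that, at a fixed grid
design `(Φ, G, c)`, a vanishing-viscosity family of ETERNAL CLASSICAL solutions `(u_j, p_j)` of the
Navier–Stokes system on `ℝ × T³` forced by the steady force `f := Φ • G`, with drift datum `∫ u_j 0 = c e₀`
and a `j`-uniform forward kinetic-energy cap `kineticEnergy (u_j t) ≤ E` for `t ≥ 0`, witnesses every
clause of the crux `ImpulseGrid.BoundedEnergyNoLeakGrid` with `u₀ j := u_j 0` (same `ν`, same `u`):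

* global Leray–Hopf: `Torus.IsClassicalNSSolutionOn.isGlobalLerayHopf` (Robinson–Rodrigo–Sadowski 2016,
  Thm. 6.5);
* per-`j` sup-energy bound: the cap itself; drift datum: copied;
* `meanEnergy (u j) ≤ 2E`: `∫‖u_j(t)‖² = 2·kineticEnergy (u_j t) ≤ 2E` for `t > 0` and
  `longTimeAvgSup_le_const` (`meanEnergy_le_of_kineticEnergy_le`);
* NO LEAKAGE (indeed mean energy EQUALITY `⟨ν‖∇u‖²⟩ = ⟨(f, u)⟩`): the exact energy equality of classical
  solutions on `[0, T]` (`Torus.IsClassicalNSSolutionOn.energy_eq`; Doering–Foias 2002 §2 (2.4)) makes the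
  running means of `ν‖∇u‖²` equal to those of the injected power `∫⟪f, u(t)⟫` plus the boundary term
  `(KE(u 0) - KE(u T))/T → 0`, the spectral dissipation of `meanDissipation` being the classical one on smooth
  slices (`Torus.gradNormSq_eq_toReal_eGradNormSq_holds`) — this is the in-tree budget lemma
  `ChainRealisation.SeparatrixFluxPinning.meanDissipation_eq_longTimeAvgSup_inner`
  (`Theorems/MarginalStabilityChainChainRealisationStubLoudOfContrast.lean`, time set `[0, ∞)`), applied to the
  restriction of the eternal solution to `[0, ∞)` (`Torus.IsClassicalNSSolutionOn.mono`);
  see `longTimeAvgSup_inner_le_meanDissipation_of_kineticEnergy_le`.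

The ten design hypotheses on `(Φ, G, c)` are carried (so that the stub is literally the skeleton's) but only
the smoothness of `Φ • G` is used (for `‖f‖₂² < ∞`).

References: C. R. Doering, C. Foias, *Energy dissipation in body-forced turbulence*, J. Fluid Mech. 467 (2002)
§2; J. C. Robinson, J. L. Rodrigo, W. Sadowski, *The Three-Dimensional Navier–Stokes Equations* (CUP 2016)
Thm. 6.5.
-/

set_option linter.dupNamespace false

noncomputable section

open MeasureTheory Filter Set
open scoped InnerProductSpace
open Literature.Analysis.FunctionSpaces Literature.Analysis.FunctionSpaces.Torus
open Literature.Analysis.FluidPDE Literature.Analysis.FluidPDE.Torus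
open Summit.AnomalousDissipation.AnomalousDissipation.Theorems.ChainRealisation.SeparatrixFluxPinning

namespace Summit.AnomalousDissipation.AnomalousDissipation.Theorems.BoundedEnergyNoLeakGrid

/-- Local notation (verbatim from the lead's skeleton, so that the registered stub signature is matched
character for character): the torus `T³`. -/
local notation "𝕋³" => UnitAddTorus (Fin 3)
/-- Local notation (verbatim from the lead's skeleton): velocity values. -/
local notation "E³" => EuclideanSpace ℝ (Fin 3)

/-! ## Mean energy and no leakage under a forward kinetic-energy cap -/

section Budget

variable {d : Type*} [Fintype d] [DecidableEq d]

omit [DecidableEq d] in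
/-- **Mean energy under a forward kinetic-energy cap**: `⟨‖u‖₂²⟩ ≤ 2E` whenever
`kineticEnergy (u t) ≤ E` for all `t ≥ 0` (`∫‖u(t)‖² = 2·kineticEnergy (u t)` and
`longTimeAvgSup_le_const`; the running means only see `t > 0`). -/
theorem meanEnergy_le_of_kineticEnergy_le {u : ℝ → UnitAddTorus d → EuclideanSpace ℝ d} {E : ℝ}
    (hE : ∀ t : ℝ, 0 ≤ t → kineticEnergy (u t) ≤ E) : meanEnergy u ≤ 2 * E := by
  rw [meanEnergy_eq_longTimeAvgSup]
  refine longTimeAvgSup_le_const (fun t => integral_nonneg fun _ => sq_nonneg _) fun t ht => ?_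
  have h1 := hE t ht.le
  unfold kineticEnergy at h1
  linarith

/-- **No Leray–Hopf leakage for eternal classical solutions with a forward energy cap** (indeed mean
energy equality): for a classical solution of the forced Navier–Stokes system on all of `ℝ × T^d` with a
steady smooth force `f` and `kineticEnergy (u t) ≤ E` for `t ≥ 0`,
`limsup_T T⁻¹∫₀ᵀ ∫⟪f, u(t)⟫ dt ≤ ⟨ν‖∇u‖₂²⟩` (with equality: the in-tree budget lemma
`meanDissipation_eq_longTimeAvgSup_inner`, Doering–Foias 2002 §2 / Robinson–Rodrigo–Sadowski 2016 Thm. 6.5,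
applied to the restriction of the solution to the time set `[0, ∞)`, `Torus.IsClassicalNSSolutionOn.mono`,
with the `L²` cap `∫‖u(t)‖² = 2·kineticEnergy (u t) ≤ 2E`). -/
theorem longTimeAvgSup_inner_le_meanDissipation_of_kineticEnergy_le {ν : ℝ}
    {f : UnitAddTorus d → EuclideanSpace ℝ d} {u : ℝ → UnitAddTorus d → EuclideanSpace ℝ d}
    {p : ℝ → UnitAddTorus d → ℝ} (h : IsClassicalNSSolutionOn univ ν (fun _ => f) u p) (hf : IsSmooth f)
    {E : ℝ} (hE : ∀ t : ℝ, 0 ≤ t → kineticEnergy (u t) ≤ E) :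
    longTimeAvgSup (fun t => ∫ x, ⟪f x, u t x⟫_ℝ) ≤ meanDissipation ν u := by
  have hC : ∀ t : ℝ, 0 ≤ t → ∫ x, ‖u t x‖ ^ 2 ≤ 2 * E := fun t ht => by
    have h1 := hE t ht
    unfold kineticEnergy at h1
    linarith
  exact (meanDissipation_eq_longTimeAvgSup_inner (h.mono (subset_univ _) (uniqueDiffOn_Ici 0)) hf hC).symm.le

end Budget

/-! ## The registered stub -/

/-- **stub_classicalWitnessReduction** (registered stub of the line `Sketch`, crux
`ImpulseGrid.BoundedEnergyNoLeakGrid`).  At a fixed grid design, a vanishing-viscosity family of eternal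
classical solutions forced by `Φ • G`, with drift datum `∫ u_j 0 = c e₀` and a `j`-uniform forward
kinetic-energy cap `kineticEnergy (u_j t) ≤ E` (`t ≥ 0`), witnesses the crux's conclusion with
`u₀ j := u_j 0`: global Leray–Hopf (`Torus.IsClassicalNSSolutionOn.isGlobalLerayHopf`), per-`j` sup-energy
(the cap), `meanEnergy (u j) ≤ 2E` (`meanEnergy_le_of_kineticEnergy_le`) and no leakage
(`longTimeAvgSup_inner_le_meanDissipation_of_kineticEnergy_le`).  Of the ten design hypotheses only the
smoothness of `Φ • G` is used. -/
theorem stub_classicalWitnessReduction :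
    ∀ (Φ : 𝕋³ → ℝ) (G : 𝕋³ → E³) (c : ℝ), IsSmooth Φ → IsSmooth G →
    (∀ (s : UnitAddCircle) x, Φ (x + Pi.single (1 : Fin 3) s) = Φ x ∧ Φ (x + Pi.single (2 : Fin 3) s) = Φ x) →
    (∫ x, Φ x = 1) → (∀ (s : UnitAddCircle) x, G (x + Pi.single (0 : Fin 3) s) = G x) → (∀ x, G x 0 = 0) →
    IsSmooth (fun x => Φ x • G x) → IsDivFree (fun x => Φ x • G x) → HasZeroMean (fun x => Φ x • G x) →
    0 < c →
    (∃ (ν : ℕ → ℝ) (u : ℕ → ℝ → 𝕋³ → E³) (p : ℕ → ℝ → 𝕋³ → ℝ) (E : ℝ),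
      (∀ j, 0 < ν j) ∧ Tendsto ν atTop (nhds 0) ∧
      (∀ j, IsClassicalNSSolutionOn Set.univ (ν j) (fun _ => fun x => Φ x • G x) (u j) (p j)) ∧
      (∀ j, ∫ x, u j 0 x = c • EuclideanSpace.single (0 : Fin 3) (1 : ℝ)) ∧
      (∀ j t, 0 ≤ t → kineticEnergy (u j t) ≤ E)) →
    ∃ (ν : ℕ → ℝ) (u₀ : ℕ → 𝕋³ → E³) (u : ℕ → ℝ → 𝕋³ → E³),
      (∀ j, 0 < ν j) ∧ Filter.Tendsto ν Filter.atTop (nhds 0) ∧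
      (∀ j, IsGlobalLerayHopf (ν j) (fun _ => fun x => Φ x • G x) (u₀ j) (u j)) ∧
      (∀ j, ∃ C : ℝ, ∀ t : ℝ, 0 ≤ t → kineticEnergy (u j t) ≤ C) ∧
      (∀ j, ∫ x, u₀ j x = c • EuclideanSpace.single 0 1) ∧
      (∃ E : ℝ, ∀ j, meanEnergy (u j) ≤ E) ∧
      (∀ j, longTimeAvgSup (fun t => ∫ x, inner ℝ (Φ x • G x) (u j t x)) ≤ meanDissipation (ν j) (u j)) := by
  intro Φ G c _ _ _ _ _ _ hfs _ _ _ hfam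
  obtain ⟨ν, u, p, E, hν, hν0, hcl, hdat, hE⟩ := hfam
  exact ⟨ν, fun j => u j 0, u, hν, hν0, fun j => (hcl j).isGlobalLerayHopf, fun j => ⟨E, hE j⟩, hdat,
    ⟨2 * E, fun j => meanEnergy_le_of_kineticEnergy_le (hE j)⟩,
    fun j => longTimeAvgSup_inner_le_meanDissipation_of_kineticEnergy_le (hcl j) hfs (hE j)⟩

end Summit.AnomalousDissipation.AnomalousDissipation.Theorems.BoundedEnergyNoLeakGrid

end
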